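import Literature.MathematicalPhysics.QuantumLattice.ComplexSourcePartitionFn
import Literature.MathematicalPhysics.QuantumLattice.DWaveSource
import Literature.MathematicalPhysics.QuantumLattice.PairFieldMomentum
import Literature.MathematicalPhysics.QuantumLattice.HubbardGaugeBound
import Literature.MathematicalPhysics.QuantumLattice.HubbardModelGrandCanonicalProofs
import HarnessLib

/-!
# Lee–Yang in the `d`-wave pair source of the Hubbard torus

Topic `Literature/MathematicalPhysics/QuantumLattice` (companion of `DWaveSource.lean` and
`ComplexSourcePartitionFn.lean`).

The grand-canonical Hubbard torus in a `d`-wave pair source,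
`H_{L,h} = dWaveSourceTorus L U μ h = hubbardTorusWith 2 L 1 U μ - h (Δ_d + Δ_d†)`, has a partition
function `Z_L(h) = tr e^{-βH_{L,h}}` that extends to an entire function of a COMPLEX source `h`.

* `partitionFn_hubbardTorusWith_sub_neg_smul_pairSource` — **`Z_L` is even in the complex source**:
  the `U(1)` gauge rotation `e^{iπN/2}` (the particle number `N` is diagonal in the occupation basis,
  commutes with the Hubbard Hamiltonian, and `[N, Δ_d] = -2Δ_d`) fixes `H` and flips the source
  (`ComplexSourcePartitionFn.partitionFn_sub_neg_smul_eq_of_grading`);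
* `gibbsState_pairSource_eq_zero` — hence `⟨Δ_d + Δ_d†⟩_{β} = 0` in the unsourced torus Gibbs state;
* **Theorem** `dWaveSource_sourcedGain_le_of_zeros_in_cone` — if every complex zero of `Z_L` lies
  in the cone `(1 + κ)(Re h)² ≤ (1 - κ)(Im h)²` (`κ = 1`: all zeros purely imaginary, which is EXACTLY
  the case at `U = 0` by the BdG product formula, `cosh(βE_k/2) = 0 ⇔ h² < 0`), then for every real
  `s` the sourced pressure gain is dominated by the zero-source Kubo–Mori–Bogoliubov `d`-wave pair
  susceptibility `χ_L = (β/L²)[(Q,Q)_Duh - ⟨Q⟩²]`, `Q = Δ_d + Δ_d†`: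

    `p̃_L(β,μ,U,s) - p̃_L(β,μ,U,0) ≤ (s²/(2κ)) · χ_L`,   `p̃_L = log Z_L/(βL²)`.

  This is the finite-volume "zeros in an imaginary cone turn the LINEAR response into a bound on
  the full NON-LINEAR response" transfer (Newman-type inequality from the location of Lee–Yang
  zeros), in the vocabulary of the `ThermalWedge` cruxes of `HubbardSuperconductivity`
  (`TwSourcedInertness`: the right-hand side is the susceptibility of
  `Theorems.tw_thermalDisc_of_discSusceptibility` at `t = 0`);
* **Theorem** `dWaveSource_sourcedGain_le_of_zeros_in_cone_near` — the LOCAL form: the cone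
  condition only for the zeros with `|h| ≤ r₀`, at the price of the far-zero constant
  `Φ_L = 7‖Q‖/(L² r₀ log 2)` (with `‖Q‖ ≤ 8√2 L²`, `Φ_L ≤ 56√2/(r₀ log 2)`, uniformly in `L` and `β`):
  `p̃_L(s) - p̃_L(0) ≤ s² ((χ_L/2 + Φ_L)/κ + Φ_L)`.

## References

* T. D. Lee, C. N. Yang, Phys. Rev. 87 (1952) 410; C. M. Newman, Comm. Math. Phys. 41 (1975) 1,
  Thm. 3 (inequalities from purely imaginary zeros).
* T. Koma, H. Tasaki, J. Stat. Phys. 76 (1994) 745, §1 (Hamiltonian with symmetry-breaking field).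
-/

noncomputable section

open scoped Matrix.Norms.L2Operator ComplexOrder
open Matrix Finset Literature.Probability.LatticeModels

namespace Literature.MathematicalPhysics.QuantumLattice

variable (L : ℕ) [NeZero L]

/-! ### The gauge grading: `N` diagonal, `[N, H] = 0`, `[N, Δ_d] = -2 Δ_d` -/

omit [NeZero L] in
/-- The particle number on the torus Fock space is the diagonal matrix `|s⟩ ↦ #s`. [folklore] -/
theorem totalNumber_torus_eq_diagonal :
    (totalNumber : Matrix (Finset (Orb (FermionTorus 2 L))) (Finset (Orb (FermionTorus 2 L))) ℂ) =
      diagonal fun s => (s.card : ℂ) := by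
  rw [← totalNumberOp_eq_totalNumber]
  -- the two sides carry different (propositionally equal) `DecidableEq` instances
  convert totalNumberOp_eq_diagonal (ι := Orb (FermionTorus 2 L))

omit [NeZero L] in
/-- `[N, H] = 0` for the grand-canonical Hubbard torus, in diagonal form. [folklore] -/
theorem diagonal_card_commutator_hubbardTorusWith (U μ : ℝ) :
    diagonal (fun s : Finset (Orb (FermionTorus 2 L)) => (s.card : ℂ)) * hubbardTorusWith 2 L 1 U μ -
      hubbardTorusWith 2 L 1 U μ * diagonal (fun s => (s.card : ℂ)) = 0 := by
  rw [← totalNumber_torus_eq_diagonal]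
  exact sub_eq_zero.2 (hamiltonianWith_commute_totalNumber (fermionTorusGraph 2 L) 1 U μ).eq.symm

/-- `[N, Δ_d] = -2 Δ_d`, in diagonal form. [folklore] -/
theorem diagonal_card_commutator_pairField :
    diagonal (fun s : Finset (Orb (FermionTorus 2 L)) => (s.card : ℂ)) * pairField dWaveFormFactor L -
      pairField dWaveFormFactor L * diagonal (fun s => (s.card : ℂ)) =
        -(2 : ℂ) • pairField dWaveFormFactor L := by
  rw [← totalNumber_torus_eq_diagonal, ← pairFieldAt_zero]
  have h := totalNumber_commutator_pairFieldAt dWaveFormFactor L 0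
  rw [h]

/-- `[N, Δ_d†] = +2 Δ_d†` (adjoint of the previous relation), in diagonal form. [folklore] -/
theorem diagonal_card_commutator_pairField_conjTranspose :
    diagonal (fun s : Finset (Orb (FermionTorus 2 L)) => (s.card : ℂ)) *
        (pairField dWaveFormFactor L)ᴴ -
      (pairField dWaveFormFactor L)ᴴ * diagonal (fun s => (s.card : ℂ)) =
        (2 : ℂ) • (pairField dWaveFormFactor L)ᴴ := by
  have h := congrArg conjTranspose (diagonal_card_commutator_pairField L)
  have hd : (diagonal fun s : Finset (Orb (FermionTorus 2 L)) => (s.card : ℂ))ᴴ =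
      diagonal fun s => (s.card : ℂ) := by
    rw [diagonal_conjTranspose]
    congr 1
    funext s
    simp
  simp only [conjTranspose_sub, conjTranspose_mul, conjTranspose_smul, hd, star_neg,
    star_ofNat] at h
  -- `h : Δᴴ N - N Δᴴ = -2 • Δᴴ`
  rw [← neg_inj, neg_sub, h, neg_smul]

/-! ### Evenness of the sourced partition function and `⟨Δ_d + Δ_d†⟩ = 0` -/

/-- **The torus partition function is even in the complex `d`-wave pair source**:
`Z_L(-h) = Z_L(h)` for every `h : ℂ` (gauge rotation `e^{iπN/2}`). [folklore] -/
theorem partitionFn_hubbardTorusWith_sub_neg_smul_pairSource (β U μ : ℝ) (h : ℂ) :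
    partitionFn β (hubbardTorusWith 2 L 1 U μ -
        (-h) • (pairField dWaveFormFactor L + (pairField dWaveFormFactor L)ᴴ)) =
      partitionFn β (hubbardTorusWith 2 L 1 U μ -
        h • (pairField dWaveFormFactor L + (pairField dWaveFormFactor L)ᴴ)) := by
  refine partitionFn_sub_neg_smul_eq_of_grading β (fun s => (s.card : ℂ)) (q := 2)
    (c := (Real.pi : ℂ) / 2 * Complex.I) ?_ ?_ ?_ ?_ h
  · exact diagonal_card_commutator_hubbardTorusWith L U μ
  · exact diagonal_card_commutator_pairField L
  · exact diagonal_card_commutator_pairField_conjTranspose L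
  · rw [show (Real.pi : ℂ) / 2 * Complex.I * 2 = Real.pi * Complex.I by ring]
    exact Complex.exp_pi_mul_I

/-- **`⟨Δ_d + Δ_d†⟩ = 0` in the torus Gibbs state** (the source is odd under the gauge rotation),
for `β ≠ 0`. [folklore] -/
theorem gibbsState_pairSource_eq_zero {β : ℝ} (hβ : β ≠ 0) (U μ : ℝ) :
    gibbsState β (hubbardTorusWith 2 L 1 U μ)
      (pairField dWaveFormFactor L + (pairField dWaveFormFactor L)ᴴ) = 0 :=
  gibbsState_eq_zero_of_even hβ (isHermitian_hamiltonianWith (fermionTorusGraph 2 L) 1 U μ)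
    (partitionFn_hubbardTorusWith_sub_neg_smul_pairSource L β U μ)

/-! ### The Lee–Yang-cone transfer for the sourced pressure gain -/

/-- **Zeros of `Z_L` in an imaginary cone bound the sourced `d`-wave pressure gain by the linear
response.** If `0 < β`, `0 < κ` and every complex zero `h` of
`Z_L(h) = tr e^{-β(H - h(Δ_d + Δ_d†))}`, `H = hubbardTorusWith 2 L 1 U μ`, satisfies
`(1 + κ)(Re h)² ≤ (1 - κ)(Im h)²`, then for every real `s`

  `p̃_L(s) - p̃_L(0) ≤ (s² / (2κ)) · (β/L²) [(Q,Q)_Duh - ⟨Q⟩²]`,  `Q = Δ_d + Δ_d†`,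

with `p̃_L(s) = log Z_β(dWaveSourceTorus L U μ s)/(βL²)` and the Kubo–Mori–Bogoliubov `d`-wave pair
susceptibility on the right evaluated at zero source. [cite: Newman1975, Thm. 3] -/
theorem dWaveSource_sourcedGain_le_of_zeros_in_cone {β : ℝ} (hβ : 0 < β) (U μ : ℝ) {κ : ℝ}
    (hκ : 0 < κ)
    (hcone : ∀ h : ℂ, partitionFn β (hubbardTorusWith 2 L 1 U μ -
        h • (pairField dWaveFormFactor L + (pairField dWaveFormFactor L)ᴴ)) = 0 →
      (1 + κ) * h.re ^ 2 ≤ (1 - κ) * h.im ^ 2)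
    (s : ℝ) :
    Real.log (partitionFn β (dWaveSourceTorus L U μ s)).re / (β * (L : ℝ) ^ 2) -
        Real.log (partitionFn β (dWaveSourceTorus L U μ 0)).re / (β * (L : ℝ) ^ 2) ≤
      s ^ 2 / (2 * κ) * (β / (L : ℝ) ^ 2 *
        ((duhamel β (dWaveSourceTorus L U μ 0)
            (pairField dWaveFormFactor L + (pairField dWaveFormFactor L)ᴴ)
            (pairField dWaveFormFactor L + (pairField dWaveFormFactor L)ᴴ)).re -
          (gibbsState β (dWaveSourceTorus L U μ 0)
            (pairField dWaveFormFactor L + (pairField dWaveFormFactor L)ᴴ)).re ^ 2)) := by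
  set H := hubbardTorusWith 2 L 1 U μ with hH
  set Q := pairField dWaveFormFactor L + (pairField dWaveFormFactor L)ᴴ with hQ
  have hHh : H.IsHermitian := isHermitian_hamiltonianWith (fermionTorusGraph 2 L) 1 U μ
  have hQh : Q.IsHermitian := isHermitian_pairField_add_conjTranspose L
  have h0 : dWaveSourceTorus L U μ 0 = H := dWaveSourceTorus_zero L U μ
  have hs : dWaveSourceTorus L U μ s = H - (s : ℂ) • Q := rfl
  have hmain := log_partitionFn_sub_smul_sub_le_of_zeros_in_cone hβ hHh hQh
    (partitionFn_hubbardTorusWith_sub_neg_smul_pairSource L β U μ) hκ hcone s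
  rw [h0, hs]
  have hL : (0 : ℝ) < (L : ℝ) ^ 2 := by
    have : (0 : ℝ) < L := Nat.cast_pos.2 (Nat.pos_of_ne_zero (NeZero.ne L))
    positivity
  have hβL : 0 < β * (L : ℝ) ^ 2 := mul_pos hβ hL
  rw [← sub_div, div_le_iff₀ hβL]
  set X : ℝ := (duhamel β H Q Q).re - (gibbsState β H Q).re ^ 2 with hX
  have hLne : (L : ℝ) ^ 2 ≠ 0 := hL.ne'
  have hre : β / (L : ℝ) ^ 2 * X * (β * (L : ℝ) ^ 2) = β ^ 2 * X := by
    rw [div_mul_eq_mul_div, div_mul_eq_mul_div, mul_mul_mul_comm, ← mul_assoc,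
      mul_div_assoc]
    rw [show (L : ℝ) ^ 2 / (L : ℝ) ^ 2 = 1 from div_self hLne]
    ring
  calc Real.log (partitionFn β (H - (s : ℂ) • Q)).re - Real.log (partitionFn β H).re
      ≤ s ^ 2 / (2 * κ) * (β ^ 2 * X) := hmain
    _ = s ^ 2 / (2 * κ) * (β / (L : ℝ) ^ 2 * X) * (β * (L : ℝ) ^ 2) := by
        rw [mul_assoc (s ^ 2 / (2 * κ)) (β / (L : ℝ) ^ 2 * X) (β * (L : ℝ) ^ 2), hre]

/-- **Local form: zeros of `Z_L` in an imaginary cone NEAR THE ORIGIN bound the sourced `d`-wave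
pressure gain.** If `0 < β`, `0 < κ`, `0 < r₀` and every complex zero `h` of `Z_L` with `|h| ≤ r₀`
satisfies `(1 + κ)(Re h)² ≤ (1 - κ)(Im h)²`, then for every real `s`

  `p̃_L(s) - p̃_L(0) ≤ s² ((χ_L/2 + Φ_L)/κ + Φ_L)`,  `Φ_L = 7‖Q‖/(L² r₀ log 2)`,

`χ_L = (β/L²)[(Q,Q)_Duh - ⟨Q⟩²]` the zero-source KMB `d`-wave pair susceptibility and `‖Q‖` the
operator norm of `Q = Δ_d + Δ_d†` (`≤ 8√2 L²`). [cite: Newman1975, Thm. 3] -/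
theorem dWaveSource_sourcedGain_le_of_zeros_in_cone_near {β : ℝ} (hβ : 0 < β) (U μ : ℝ)
    {κ r₀ : ℝ} (hκ : 0 < κ) (hr₀ : 0 < r₀)
    (hcone : ∀ h : ℂ, partitionFn β (hubbardTorusWith 2 L 1 U μ -
        h • (pairField dWaveFormFactor L + (pairField dWaveFormFactor L)ᴴ)) = 0 → ‖h‖ ≤ r₀ →
      (1 + κ) * h.re ^ 2 ≤ (1 - κ) * h.im ^ 2)
    (s : ℝ) :
    Real.log (partitionFn β (dWaveSourceTorus L U μ s)).re / (β * (L : ℝ) ^ 2) -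
        Real.log (partitionFn β (dWaveSourceTorus L U μ 0)).re / (β * (L : ℝ) ^ 2) ≤
      s ^ 2 * (((β / (L : ℝ) ^ 2 *
        ((duhamel β (dWaveSourceTorus L U μ 0)
            (pairField dWaveFormFactor L + (pairField dWaveFormFactor L)ᴴ)
            (pairField dWaveFormFactor L + (pairField dWaveFormFactor L)ᴴ)).re -
          (gibbsState β (dWaveSourceTorus L U μ 0)
            (pairField dWaveFormFactor L + (pairField dWaveFormFactor L)ᴴ)).re ^ 2)) / 2 +
          7 * ‖pairField dWaveFormFactor L + (pairField dWaveFormFactor L)ᴴ‖ /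
            ((L : ℝ) ^ 2 * r₀ * Real.log 2)) / κ +
        7 * ‖pairField dWaveFormFactor L + (pairField dWaveFormFactor L)ᴴ‖ /
          ((L : ℝ) ^ 2 * r₀ * Real.log 2)) := by
  set H := hubbardTorusWith 2 L 1 U μ with hH
  set Q := pairField dWaveFormFactor L + (pairField dWaveFormFactor L)ᴴ with hQ
  have hHh : H.IsHermitian := isHermitian_hamiltonianWith (fermionTorusGraph 2 L) 1 U μ
  have hQh : Q.IsHermitian := isHermitian_pairField_add_conjTranspose L
  have h0 : dWaveSourceTorus L U μ 0 = H := dWaveSourceTorus_zero L U μ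
  have hs : dWaveSourceTorus L U μ s = H - (s : ℂ) • Q := rfl
  have hmain := log_partitionFn_sub_smul_sub_le_of_zeros_in_cone_near hβ hHh hQh
    (partitionFn_hubbardTorusWith_sub_neg_smul_pairSource L β U μ) hκ hr₀ hcone s
  rw [h0, hs]
  have hL : (0 : ℝ) < (L : ℝ) ^ 2 := by
    have : (0 : ℝ) < L := Nat.cast_pos.2 (Nat.pos_of_ne_zero (NeZero.ne L))
    positivity
  have hβL : 0 < β * (L : ℝ) ^ 2 := mul_pos hβ hL
  have hlog2 : 0 < Real.log 2 := Real.log_pos (by norm_num)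
  have hLne : (L : ℝ) ≠ 0 := by exact_mod_cast NeZero.ne L
  rw [← sub_div, div_le_iff₀ hβL]
  refine hmain.trans (le_of_eq ?_)
  field_simp

end Literature.MathematicalPhysics.QuantumLattice
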